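import Summits.CriticalPhenomena.PercolationContinuityZ3.Theorems.PercNearOneGluingNoHeavyQuantGateStepN
import Summits.CriticalPhenomena.PercolationContinuityZ3.Theorems.PercNearOneGluingNoHeavyQuantTwoRootGateCoupling
import Summits.CriticalPhenomena.PercolationContinuityZ3.Theorems.PercNearOneGluingNoHeavyQuantGatedSliceWindowReductionPrime
import HarnessLib

/-!
# QUANT lane R8, T-DEC: THE FREE SUB-CASES OF `GateStepN` — a BLOB increment (the slice theorems) and a SINGLE-TREE environment
# (arm-1 g45's two-root identity) are theorems inside the node with the full induction hypothesis; THE CORE NODE `GateStepNCore`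
# (environment a genuine convolution, increment not a blob) and `GatedSliceMixLaw' ∧ GateStepNCore ⟹ GateStepN ⟹ FarTreeRow`

builds on p205010 (kernel theorem, internal audit signed; external expert review pending)

Support file (`--supports stmt-CriticalPhenomena-4575`), QUANT lane lead seat prim-quant-lead (gen 42), rung R8 of
`run/shared/lean/prim/quant/LADDER.md`.  One `@[conjecture]` (`LawDec.GateStepNCore`), theorems with standard axioms, no sorries.  Continues the lead's
`…QuantGateStepN` (`TreeBuiltN`, `GateStepN`), arm-1 g45's `…QuantTwoRootGateCoupling` (✓ p392934, `sdec_twoRoot_of_opened`) and the blob gate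
step CW (`sdec_slice_blob_of_mixLaw'`; the discharge `gatedSliceMixLaw'_holds` ✓ p373052 lives in `…GatedSliceMixLawNodeHolds`, whose olean is
not available on the check farm at filing time — so the blob case is stated with `GatedSliceMixLaw'` as a hypothesis, to be fed `gatedSliceMixLaw'_holds`).

THE NODE `LawDec.GateStepN` (lead g42) reads: for a gate budget `n`, given the ORACLE "every `TreeBuiltN` law with `< n` nontrivial gates is SDEC",
a tree-built forest `μ₁` (`n₁` gates, floor `x`) beside one more tree `gate c g` (`c` tree-built with `n₂` gates at floor `x/g`, `n₁ + n₂ + 1 ≤ n`,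
`0 < x < g < 1`) is SDEC at `x`.  README V393 lists the FREE steps of the gate-elimination architecture; this file proves two of them INSIDE the node,
i.e. as theorems with exactly the node's binder plus a side condition:

* **`gateStepN_of_point`** (given `GatedSliceMixLaw'`, a theorem of the tree: `gatedSliceMixLaw'_holds`) — the increment is a BLOB: `c = δ_{M₂}`
  (a gate `g` over `M₂` sure relays).  Then `μ₁ ∗ gate_g δ_{M₂} = slice μ₁ M₂ g` (`lconv_gate_point_eq_slice`) and the blob slice theorem
  `sdec_slice_blob_of_mixLaw'` applies to `μ₁`, which is SDEC by the oracle (`n₁ < n`).  (`M₂ = 0`: nothing to do.)  **`gateStepN_of_relay`** —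
  the increment is a single RELAY (`M₂ = 1`): unconditional (`sdec_slice_relay`).
* **`gateStepN_of_tree`** — the environment is a SINGLE TREE: `μ₁ = gate ρ₁ q₁` with `ρ₁` tree-built (`n₁'` gates, floor `x₁`, `x ≤ q₁·x₁`,
  `0 < q₁ < 1`, `n₁' + n₂ + 2 ≤ n`).  Then arm-1's `sdec_twoRoot_of_opened` applies: its three SDEC hypotheses — `ρ₁`, `c`, and the OPENED forest
  `ρ_heavy ∗ gate_{q_light/q_heavy} ρ_light` (one gate fewer: `n₁' + n₂ + 1 < n`, floor `x/q_heavy`) — are oracle instances (`TreeBuiltN.conv`,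
  `.gate`, `.mono`); the two orders `g ≤ q₁` / `q₁ < g` by `lconv_comm`; the tie `g = q₁` needs no re-gate (`gate_one`).
* `TreeBuiltN.top_pos` (the top atom of a tree-built law is charged), `TreeBuiltN.shape` (a tree-built law is `δ₀`/`δ₁`, a
  convolution at the same floor, or a gated tree — floor-lowerings absorbed).
* **`@[conjecture] LawDec.GateStepNCore`** — `GateStepN` restricted to an environment `a ∗ b` (both tree-built at the floor) and an increment whose
  sub-forest law is not a point mass; **`gateStepN_of_core : GatedSliceMixLaw' → GateStepNCore → GateStepN`** (by `shape` of the environment and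
  `by_cases` on the increment), `gateStepNCore_of_gateStepN`, **`Quant.farTreeRow_of_gateStepNCore`**.
So, in the kernel: **the open content of `GateStepN` (hence of `FarTreeRow` along this route) is `GateStepNCore` — an environment that is a genuine
convolution beside a NON-blob tree** — README V393's open core as a named node (it still contains some free instances, e.g. `δ_K ∗ tree`).

HONEST STATUS: `GateStepN`, `FarTreeRow` OPEN; RATE class log\* and the honest sentence unchanged.
[this work]; two-root identity: prim-quant-arm-1 g45; CW: this lane (gens 29–36).  Nothing here is cited as a published result.  The gluing rows
served [cite: KozmaNitzan2024, Conjecture 3 (p. 15)]; product measure [cite: Grimmett1999, §1.3 p. 10].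
-/

noncomputable section

namespace Summit.CriticalPhenomena.PercolationContinuityZ3.Theorems

namespace Quant

open Finset

namespace LawDec

/-- **THE BLOB INCREMENT IS FREE inside `GateStepN`** (modulo `GatedSliceMixLaw'`, a theorem of the tree: feed `gatedSliceMixLaw'_holds`).  With
the node's binder and `c = δ_{M₂}`: `SDEC x (M₁ + M₂) (μ₁ ∗ gate_g δ_{M₂})` (the blob slice theorem applied to `μ₁`, SDEC by the oracle). [this work] -/
theorem gateStepN_of_point (hL : GatedSliceMixLaw') (n : ℕ) (x g : ℝ) (n₁ n₂ M₁ M₂ : ℕ) (μ₁ c : ℕ → ℝ)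
    (hO : ∀ (x' : ℝ) (n' M' : ℕ) (μ' : ℕ → ℝ), n' < n → TreeBuiltN x' n' M' μ' → SDEC x' M' μ')
    (hn : n₁ + n₂ + 1 ≤ n) (hx0 : 0 < x) (hxg : x < g) (hg1 : g < 1)
    (h₁ : TreeBuiltN x n₁ M₁ μ₁) (_hc : TreeBuiltN (x / g) n₂ M₂ c)
    (hpt : c = fun h => if h = M₂ then (1 : ℝ) else 0) :
    SDEC x (M₁ + M₂) (lconv M₁ M₂ μ₁ (gate c g)) := by
  obtain ⟨_, hx1, n1, z1, s1, t1⟩ := h₁.lawFacts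
  have hS1 : SDEC x M₁ μ₁ := hO x n₁ M₁ μ₁ (by omega) h₁
  subst hpt
  rw [lconv_gate_point_eq_slice M₁ M₂ μ₁ g z1]
  rcases Nat.eq_zero_or_pos M₂ with hM | hM
  · -- `slice μ₁ 0 g = μ₁`
    subst hM
    have e : slice μ₁ 0 g = μ₁ := by
      funext h; simp only [slice, Nat.zero_le, if_true, Nat.sub_zero]; ring
    rw [e]
    exact hS1
  · exact sdec_slice_blob_of_mixLaw' hL x g M₁ M₂ μ₁ hx0 hx1 hxg.le hg1.le hM n1 z1 s1 t1 hS1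

/-- **THE RELAY INCREMENT IS FREE inside `GateStepN`** (unconditional): with the node's binder and `c = δ₁` (`M₂ = 1`),
`SDEC x (M₁ + 1) (μ₁ ∗ gate_g δ₁)` by `sdec_slice_relay`. [this work] -/
theorem gateStepN_of_relay (n : ℕ) (x g : ℝ) (n₁ n₂ M₁ : ℕ) (μ₁ c : ℕ → ℝ)
    (hO : ∀ (x' : ℝ) (n' M' : ℕ) (μ' : ℕ → ℝ), n' < n → TreeBuiltN x' n' M' μ' → SDEC x' M' μ')
    (hn : n₁ + n₂ + 1 ≤ n) (hx0 : 0 < x) (hxg : x < g) (hg1 : g < 1)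
    (h₁ : TreeBuiltN x n₁ M₁ μ₁) (_hc : TreeBuiltN (x / g) n₂ 1 c)
    (hpt : c = fun h => if h = 1 then (1 : ℝ) else 0) :
    SDEC x (M₁ + 1) (lconv M₁ 1 μ₁ (gate c g)) := by
  obtain ⟨_, hx1, n1, z1, s1, t1⟩ := h₁.lawFacts
  have hS1 : SDEC x M₁ μ₁ := hO x n₁ M₁ μ₁ (by omega) h₁
  subst hpt
  rw [lconv_gate_point_eq_slice M₁ 1 μ₁ g z1]
  exact sdec_slice_relay x g M₁ μ₁ hx0 hx1 hxg.le hg1.le n1 z1 s1 t1 hS1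

/-- the opened two-tree forest is an oracle instance: `ρ_h ∗ gate_r ρ_l` at floor `w` with `n₁' + n₂ (+1)` gates is SDEC when
`n₁' + n₂ + 1 < n` (both orders of the re-gate `r ≤ 1`, `r = 1` without a gate). [this work] -/
theorem sdec_opened_of_oracle (n : ℕ) (w r : ℝ) (na nb Ma Mb : ℕ) (ρa ρb : ℕ → ℝ)
    (hO : ∀ (x' : ℝ) (n' M' : ℕ) (μ' : ℕ → ℝ), n' < n → TreeBuiltN x' n' M' μ' → SDEC x' M' μ')
    (hn : na + nb + 1 < n) (hw0 : 0 < w) (hr0 : 0 < r) (hr1 : r ≤ 1)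
    (ha : TreeBuiltN w na Ma ρa) (hb : TreeBuiltN (w / r) nb Mb ρb) :
    SDEC w (Ma + Mb) (lconv Ma Mb ρa (gate ρb r)) := by
  rcases eq_or_lt_of_le hr1 with hr | hr
  · subst hr
    rw [gate_one]
    rw [div_one] at hb
    exact hO w (na + nb) (Ma + Mb) _ (by omega) (TreeBuiltN.conv ha hb)
  · have hgb : TreeBuiltN (r * (w / r)) (nb + 1) Mb (gate ρb r) := TreeBuiltN.gate r hr0 hr hb
    have e : r * (w / r) = w := by field_simp
    rw [e] at hgb
    exact hO w (na + (nb + 1)) (Ma + Mb) _ (by omega) (TreeBuiltN.conv ha hgb)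

/-- **THE SINGLE-TREE ENVIRONMENT IS FREE inside `GateStepN`** (arm-1 g45's two-root identity fed by the oracle).  With the node's binder and
`μ₁ = gate ρ₁ q₁` (`ρ₁` tree-built with `n₁'` gates at a floor `x₁`, `x ≤ q₁ x₁`, `0 < q₁ < 1`, `n₁' + n₂ + 2 ≤ n`):
`SDEC x (M₁ + M₂) (gate_{q₁} ρ₁ ∗ gate_g c)`. [this work] -/
theorem gateStepN_of_tree (n : ℕ) (x g q₁ x₁ : ℝ) (n₁' n₂ M₁ M₂ : ℕ) (ρ₁ c : ℕ → ℝ)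
    (hO : ∀ (x' : ℝ) (n' M' : ℕ) (μ' : ℕ → ℝ), n' < n → TreeBuiltN x' n' M' μ' → SDEC x' M' μ')
    (hn : n₁' + n₂ + 2 ≤ n) (hx0 : 0 < x) (hxg : x < g) (hg1 : g < 1) (hq0 : 0 < q₁) (hq1 : q₁ < 1) (hxq : x ≤ q₁ * x₁)
    (hρ : TreeBuiltN x₁ n₁' M₁ ρ₁) (hc : TreeBuiltN (x / g) n₂ M₂ c) :
    SDEC x (M₁ + M₂) (lconv M₁ M₂ (gate ρ₁ q₁) (gate c g)) := by
  have hg0 : 0 < g := lt_trans hx0 hxg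
  obtain ⟨hx₁0, hx₁1, r0, rM, r1, rta⟩ := hρ.lawFacts
  obtain ⟨hy0, hy1, c0, cM, c1, cta⟩ := hc.lawFacts
  have hSρ : SDEC x₁ M₁ ρ₁ := hO x₁ n₁' M₁ ρ₁ (by omega) hρ
  have hSc : SDEC (x / g) M₂ c := hO (x / g) n₂ M₂ c (by omega) hc
  have hxg' : x ≤ g * (x / g) := by rw [mul_div_cancel₀ x hg0.ne']
  rcases le_or_gt g q₁ with hgq | hqg
  · -- heavy root `q₁`: open `ρ₁`, re-gate `c` to `g/q₁`; opened forest at floor `x/q₁`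
    have hw0 : 0 < x / q₁ := div_pos hx0 hq0
    have hρ' : TreeBuiltN (x / q₁) n₁' M₁ ρ₁ :=
      TreeBuiltN.mono hρ hw0 (by rw [div_le_iff₀ hq0]; linarith [mul_comm q₁ x₁])
    have hr0 : 0 < g / q₁ := div_pos hg0 hq0
    have hr1 : g / q₁ ≤ 1 := by rw [div_le_one hq0]; exact hgq
    have e : x / q₁ / (g / q₁) = x / g := by field_simp
    have hc' : TreeBuiltN (x / q₁ / (g / q₁)) n₂ M₂ c := by rw [e]; exact hc
    have hG : SDEC (x / q₁) (M₁ + M₂) (lconv M₁ M₂ ρ₁ (gate c (g / q₁))) :=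
      sdec_opened_of_oracle n (x / q₁) (g / q₁) n₁' n₂ M₁ M₂ ρ₁ c hO (by omega) hw0 hr0 hr1 hρ' hc'
    have hwG1 : x / q₁ < 1 := by
      rw [div_lt_one hq0]; nlinarith
    exact sdec_twoRoot_of_opened x₁ (x / g) (x / q₁) x q₁ g M₁ M₂ ρ₁ c hx₁0 hx₁1 hy0 hy1 hw0.le hwG1 hg0 hgq hq1 hx0
      r0 rM r1 rta c0 cM c1 cta hSρ hSc hG hxq hxg' (by rw [mul_div_cancel₀ x hq0.ne'])
  · -- heavy root `g`: swap the factors (`lconv_comm`), open `c`, re-gate `ρ₁` to `q₁/g`; opened forest at floor `x/g`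
    rw [lconv_comm, Nat.add_comm]
    have hr0 : 0 < q₁ / g := div_pos hq0 hg0
    have hr1 : q₁ / g ≤ 1 := by rw [div_le_one hg0]; exact hqg.le
    have e : x / g / (q₁ / g) = x / q₁ := by field_simp
    have hρ' : TreeBuiltN (x / g / (q₁ / g)) n₁' M₁ ρ₁ := by
      rw [e]
      exact TreeBuiltN.mono hρ (div_pos hx0 hq0) (by rw [div_le_iff₀ hq0]; linarith [mul_comm q₁ x₁])
    have hG : SDEC (x / g) (M₂ + M₁) (lconv M₂ M₁ c (gate ρ₁ (q₁ / g))) :=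
      sdec_opened_of_oracle n (x / g) (q₁ / g) n₂ n₁' M₂ M₁ c ρ₁ hO (by omega) hy0 hr0 hr1 hc hρ'
    exact sdec_twoRoot_of_opened (x / g) x₁ (x / g) x g q₁ M₂ M₁ c ρ₁ hy0 hy1 hx₁0 hx₁1 hy0.le hy1 hq0 hqg.le hg1 hx0
      c0 cM c1 cta r0 rM r1 rta hSc hSρ hG hxg' hxq hxg'


/-! ### The top atom of a tree-built law is charged -/

/-- **the top atom of a tree-built law is charged**: `TreeBuiltN x n M μ → 0 < μ M` (every relay reached has positive probability). [this work] -/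
theorem TreeBuiltN.top_pos {x : ℝ} {n M : ℕ} {μ : ℕ → ℝ} (h : TreeBuiltN x n M μ) : 0 < μ M := by
  induction h with
  | nil x₀ hx0 hx1 => simp
  | relay x₀ hx0 hx1 => simp
  | @conv x₀ na nb Ma Mb a b _ _ iha ihb =>
    -- `(a ∗ b)(Ma + Mb) = a Ma · b Mb` (only the pair of tops reaches the top; = typer g35's `lconv_top`, whose module is not built on the
    -- check farm at filing time — inlined)
    have e : lconv Ma Mb a b (Ma + Mb) = a Ma * b Mb := by
      simp only [lconv]
      rw [Finset.sum_eq_single Ma]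
      · rw [Finset.sum_eq_single Mb]
        · rw [if_pos rfl]
        · intro k hk hkM
          rw [Finset.mem_range] at hk
          rw [if_neg (by omega)]
        · intro hM; exact absurd (Finset.mem_range.2 (Nat.lt_succ_self Mb)) hM
      · intro i hi hiM
        rw [Finset.mem_range] at hi
        refine Finset.sum_eq_zero fun k hk => ?_
        rw [Finset.mem_range] at hk
        rw [if_neg (by omega)]
      · intro hM; exact absurd (Finset.mem_range.2 (Nat.lt_succ_self Ma)) hM
    rw [e]; exact mul_pos iha ihb
  | @gate x₀ n₀ M₀ ρ q hq0 hq1 _ ih =>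
    simp only [LawDec.gate]
    split_ifs <;> nlinarith [mul_pos hq0 ih]
  | mono _ _ _ ih => exact ih

/-! ### The shape of a `TreeBuiltN` law, and the CORE of the node -/

/-- **shape of a tree-built law**: a `TreeBuiltN x n M μ` is `δ₀` or `δ₁` (no gate), or a CONVOLUTION of two `TreeBuiltN` laws at the same floor `x`
(gate counts and tops adding up), or a GATED law `gate ρ q` (`0 < q < 1`, `ρ` tree-built at a floor `x₁` with `x ≤ q·x₁`, one gate more) —
floor-lowering steps are absorbed. [this work] -/
theorem TreeBuiltN.shape {x : ℝ} {n M : ℕ} {μ : ℕ → ℝ} (h : TreeBuiltN x n M μ) :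
    (n = 0 ∧ ((M = 0 ∧ μ = fun k => if k = 0 then (1 : ℝ) else 0) ∨ (M = 1 ∧ μ = fun k => if k = 1 then (1 : ℝ) else 0))) ∨
    (∃ (na nb Ma Mb : ℕ) (a b : ℕ → ℝ), n = na + nb ∧ M = Ma + Mb ∧ μ = lconv Ma Mb a b ∧
        TreeBuiltN x na Ma a ∧ TreeBuiltN x nb Mb b) ∨
    (∃ (n' : ℕ) (q x₁ : ℝ) (ρ : ℕ → ℝ), n = n' + 1 ∧ μ = LawDec.gate ρ q ∧ 0 < q ∧ q < 1 ∧ x ≤ q * x₁ ∧ TreeBuiltN x₁ n' M ρ) := by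
  induction h with
  | nil x₀ hx0 hx1 => exact Or.inl ⟨rfl, Or.inl ⟨rfl, rfl⟩⟩
  | relay x₀ hx0 hx1 => exact Or.inl ⟨rfl, Or.inr ⟨rfl, rfl⟩⟩
  | @conv x₀ na nb Ma Mb a b ha hb _ _ => exact Or.inr (Or.inl ⟨na, nb, Ma, Mb, a, b, rfl, rfl, rfl, ha, hb⟩)
  | @gate x₀ n₀ M₀ ρ q hq0 hq1 hρ _ => exact Or.inr (Or.inr ⟨n₀, q, x₀, ρ, rfl, rfl, hq0, hq1, le_rfl, hρ⟩)
  | @mono x₀ x'' n₀ M₀ μ₀ h hx''0 hxx ih =>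
    rcases ih with h0 | ⟨na, nb, Ma, Mb, a, b, hn, hM, hμ, ha, hb⟩ | ⟨n', q, x₁, ρ, hn, hμ, hq0, hq1, hxq, hρ⟩
    · exact Or.inl h0
    · exact Or.inr (Or.inl ⟨na, nb, Ma, Mb, a, b, hn, hM, hμ, TreeBuiltN.mono ha hx''0 hxx, TreeBuiltN.mono hb hx''0 hxx⟩)
    · exact Or.inr (Or.inr ⟨n', q, x₁, ρ, hn, hμ, hq0, hq1, le_trans hxx hxq, hρ⟩)

/-- **CONJECTURE (THE CORE OF THE GATE STEP; lead g42).**  `GateStepN` restricted to an environment that is a genuine CONVOLUTION `a ∗ b` of two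
tree-built laws (not a single gated tree, not a bare `δ₀`/`δ₁`) beside an increment `gate c g` whose sub-forest law `c` is NOT a point mass (not a
blob / relay): for a budget `n` with the oracle "every `TreeBuiltN` law with `< n` gates is SDEC", `TreeBuiltN x na Ma a`, `TreeBuiltN x nb Mb b`,
`TreeBuiltN (x/g) n₂ M₂ c`, `na + nb + n₂ + 1 ≤ n`, `0 < x < g < 1`, `c ≠ δ_K` for every `K`:  `SDEC x ((Ma + Mb) + M₂) ((a ∗ b) ∗ gate c g)`.
With `GatedSliceMixLaw'` (✓ `gatedSliceMixLaw'_holds`, the blob gate step CW) this core IMPLIES the whole node (`gateStepN_of_core`: the other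
shapes of the environment and the point-mass increments are `gateStepN_of_tree` / `_of_point` / `sdec_gate` / `sdec_slice_relay`), hence
`Quant.FarTreeRow` (`farTreeRow_of_gateStepNCore`).  README V393: this is the OPEN CORE of the gate-elimination architecture ('a gate over ≥ 3
non-blob siblings', up to the free sub-instances it still contains); README V394: its count law is, in every one of ≈ 7 200 tested instances, a
mixture of oracle laws (RCM).  builds on p205010 (kernel theorem, internal audit signed; external expert review pending). [this work] [status: open] -/
@[conjecture] def GateStepNCore : Prop :=
  ∀ (n : ℕ) (x g : ℝ) (na nb n₂ Ma Mb M₂ : ℕ) (a b c : ℕ → ℝ),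
    (∀ (x' : ℝ) (n' M' : ℕ) (μ' : ℕ → ℝ), n' < n → TreeBuiltN x' n' M' μ' → SDEC x' M' μ') →
    na + nb + n₂ + 1 ≤ n → 0 < x → x < g → g < 1 →
    TreeBuiltN x na Ma a → TreeBuiltN x nb Mb b → TreeBuiltN (x / g) n₂ M₂ c →
    (∀ K : ℕ, c ≠ fun h => if h = K then (1 : ℝ) else 0) →
    SDEC x (Ma + Mb + M₂) (lconv (Ma + Mb) M₂ (lconv Ma Mb a b) (gate c g))

/-- `GateStepN ⟹ GateStepNCore` (the core is a special case). [this work] -/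
theorem gateStepNCore_of_gateStepN (hG : GateStepN) : GateStepNCore := by
  intro n x g na nb n₂ Ma Mb M₂ a b c hO hn hx0 hxg hg1 ha hb hc _
  exact hG n x g (na + nb) n₂ (Ma + Mb) M₂ (lconv Ma Mb a b) c hO (by omega) hx0 hxg hg1 (TreeBuiltN.conv ha hb) hc

/-- **THE CORE SUFFICES: `GatedSliceMixLaw' ∧ GateStepNCore ⟹ GateStepN`.**  By `TreeBuiltN.shape` of the environment: `δ₀` (`sdec_gate` on the
increment), `δ₁` (a sure relay beside the increment: `sdec_slice_relay` with the sure gate), a single gated tree (`gateStepN_of_tree`), or a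
convolution — then by cases on the increment: a point mass (`gateStepN_of_point`) or the core. [this work] -/
theorem gateStepN_of_core (hL : GatedSliceMixLaw') (hC : GateStepNCore) : GateStepN := by
  intro n x g n₁ n₂ M₁ M₂ μ₁ c hO hn hx0 hxg hg1 h₁ hc
  have hg0 : 0 < g := lt_trans hx0 hxg
  obtain ⟨hy0, hy1, c0, cM, c1, cta⟩ := hc.lawFacts
  have hSc : SDEC (x / g) M₂ c := hO (x / g) n₂ M₂ c (by omega) hc
  -- the increment alone, at floor `x`
  have hSgc : SDEC x M₂ (gate c g) := by
    have := sdec_gate hSc g hg0 hg1.le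
    rwa [mul_div_cancel₀ x hg0.ne'] at this
  rcases h₁.shape with ⟨_, ⟨hM, hμ⟩ | ⟨hM, hμ⟩⟩ | ⟨na, nb, Ma, Mb, a, b, hn', hM, hμ, ha, hb⟩ | ⟨n', q, x₁, ρ, hn', hμ, hq0, hq1, hxq, hρ⟩
  · -- environment `δ₀`
    subst hM; subst hμ
    have hgM : ∀ h, M₂ < h → gate c g h = 0 := by
      intro h hh; simp only [LawDec.gate]; rw [cM h hh, if_neg (by omega)]; ring
    have e : lconv 0 M₂ (fun k => if k = 0 then (1 : ℝ) else 0) (gate c g) = gate c g :=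
      funext fun h => lconv_delta_left 0 M₂ (gate c g) hgM h
    rw [e, Nat.zero_add]
    exact hSgc
  · -- environment `δ₁` (a sure relay beside the increment)
    subst hM; subst hμ
    have hgM : ∀ h, M₂ < h → gate c g h = 0 := by
      intro h hh; simp only [LawDec.gate]; rw [cM h hh, if_neg (by omega)]; ring
    have hg0' : ∀ h, 0 ≤ gate c g h := by
      intro h; simp only [LawDec.gate]; split_ifs <;> nlinarith [c0 h]
    have hg1' : ∑ h ∈ Finset.range (M₂ + 1), gate c g h = 1 := sum_gate c g M₂ c1
    have htag : x * (M₂ : ℝ) ≤ ∑ h ∈ Finset.range (M₂ + 1), (h : ℝ) * gate c g h := by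
      rw [sum_mul_gate]
      have := mul_le_mul_of_nonneg_left cta hg0.le
      have e : g * (x / g * (M₂ : ℝ)) = x * (M₂ : ℝ) := by rw [← mul_assoc, mul_div_cancel₀ x hg0.ne']
      linarith [e]
    rw [lconv_comm, Nat.add_comm, lconv_relay_right M₂ (gate c g) hgM]
    exact sdec_slice_relay x 1 M₂ (gate c g) hx0 (by linarith) (by linarith) le_rfl hg0' hgM hg1' htag hSgc
  · -- environment a convolution: the increment is a blob, or THE CORE
    subst hM; subst hμ
    by_cases hpt : ∃ K : ℕ, c = fun h => if h = K then (1 : ℝ) else 0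
    · obtain ⟨K, hK⟩ := hpt
      -- the top atom of a tree-built law is charged, so a tree-built point mass on `{0..M₂}` is `δ_{M₂}`
      have hKM : K = M₂ := by
        by_contra hne
        have htop := hc.top_pos
        rw [hK] at htop
        simp only at htop
        rw [if_neg (Ne.symm hne)] at htop
        exact lt_irrefl _ htop
      subst hKM
      exact gateStepN_of_point hL n x g (na + nb) n₂ (Ma + Mb) K (lconv Ma Mb a b) c hO (by omega) hx0 hxg hg1
        (TreeBuiltN.conv ha hb) hc hK
    · exact hC n x g na nb n₂ Ma Mb M₂ a b c hO (by omega) hx0 hxg hg1 ha hb hc (fun K hK => hpt ⟨K, hK⟩)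
  · -- environment a single gated tree
    subst hμ
    exact gateStepN_of_tree n x g q x₁ n' n₂ M₁ M₂ ρ c hO (by omega) hx0 hxg hg1 hq0 hq1 hxq hρ hc

end LawDec

/-- **`GatedSliceMixLaw' ∧ GateStepNCore ⟹ Quant.FarTreeRow`** — the R8 tree row from the blob gate step (a theorem of the tree,
`gatedSliceMixLaw'_holds`) and the CORE of the gate step (environment a genuine convolution, increment not a blob). [this work] -/
theorem farTreeRow_of_gateStepNCore (hL : LawDec.GatedSliceMixLaw') (hC : LawDec.GateStepNCore) : FarTreeRow :=
  farTreeRow_of_gateStepN (LawDec.gateStepN_of_core hL hC)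

end Quant

end Summit.CriticalPhenomena.PercolationContinuityZ3.Theorems
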